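import Summits.BirchSwinnertonDyer.BirchSwinnertonDyer.Theorems.ThetaPartnerAtTwoMazurTateCongruenceAtTwoRDilationInvariance
import Summits.BirchSwinnertonDyer.BirchSwinnertonDyer.Theorems.ResidualThetaTransportAtTwoThetaLayerLambdaCongruenceAtTwoResidualReduction
import HarnessLib

/-!
# Crux `MazurTateCongruenceAtTwoTop` (stmt-BirchSwinnertonDyer-25797 = `MazurTateCongruenceAtTwoR` 21416), line `symbol` v4:
# (IH₂-core) — an integral `Γ₀(N')`-symbol function `ℚ → ℚ̄₂`, Hecke-congruent to a NON-Eisenstein system and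
# `ℤ[1/ℓ]`-PERIODIC modulo `𝔪`, is `≡ 0 (mod 𝔪)` (width seat bsd-wall-tp2-p1-w3 g0; `--supports stmt-BirchSwinnertonDyer-25797`)

HONEST FRAMING. THEOREMS ONLY (no `def`, no named fact, no `sorry`). The non-Eisenstein hypothesis on the eigenvalue system is
EXPLICIT; nothing about any curve or about BSD is asserted.

WHY. Skeleton `symbol` v4 (lead tp2-p1 g11) registered `stub_iharaSymbolModTwo` = (IH₂-core): «a `1`-periodic even `Γ₀(N')`-symbol
function `Φ : ℚ → ℚ̄₂`, integral, Hecke-congruent to `a_q(W)` off `2N'ℓ`, and `ℤ[1/ℓ]`-periodic mod `𝔪` (`Φ(r + j/ℓⁿ) ≡ Φ(r)`), is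
`≡ 0 mod 𝔪`», the load-bearing input of the depletion-primitivity road (p627867). THIS FILE proves it, for every system of
eigenvalues `a : ℕ → ℤ` that is NOT weight-`2` Eisenstein in characteristic `2` (for `a = a_q(W)` this is the `S₃`-image
condition, i.e. `W[2]` irreducible with `Δ_W < 0`; for `C₃`-image the statement fails: Eisenstein boundary symbols), from the
engine `eq_zero_of_dilationInvariant` (`…RDilationInvariance`, Ihara's lemma for symbol functions via cell bsd-f2-manin's
`relativeIharaShiftVanishingBar_holds`):
* §1 `ℤ[1/ℓ]`-TRANSLATION invariance ⟹ DILATION invariance by `ℓ^{2k}`, over any additive group, by the identity in `SL₂(ℤ[1/ℓ])`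
  `diag(ℓ^{-k}, ℓ^{k}) = (1 a; 0 1)(1 0; c 1)(1 b; 0 1)(1 0; d 1)`, `a = ℓ^{-(2k+e)}`, `c = −ℓ^{k+e}(ℓ^k − 1)`, `b = −ℓ^{-(k+e)}`,
  `d = ℓ^e(ℓ^k − 1)`, where `N' = ℓ^e M`, `ℓ ∤ M`, `M ∣ ℓ^k − 1` (Euler) — so both lower unipotents lie in `Γ₀(N')` (`ℓ ∣ N'`
  allowed) — composed through the cocycle law `Φ̃(g x) = Φ̃(g ∞) + Φ̃(x)` (`elim_mapGL_smul`);
* §2 reduction modulo the maximal ideal of `𝒪_{ℚ̄₂}` (the dictionary of `…ResidualReduction`) and `eq_zero_of_dilationInvariant` at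
  `(p, t, n) = (2, ℓ, 2k)`: `norm_lt_one_of_translationInvariant` (abstract `a`), `iharaSymbolModTwo_of_notEisenstein` (the stub's
  shape for `a = a_q(W)`, with the non-Eisenstein input explicit).

References: Greenberg–Vatsal, Invent. Math. 142 (2000) §3; K. Ribet, ICM 1983 Thm. 4.1; cell bsd-f2-manin MEMO-es §21–§23.
-/

-- justification: the `Summit.BirchSwinnertonDyer.BirchSwinnertonDyer.…` path repeats a component (route-file convention)
set_option linter.dupNamespace false
set_option autoImplicit false

noncomputable section

open scoped MatrixGroups

open CongruenceSubgroup Matrix.SpecialLinearGroup Literature.NumberTheory.EllipticCurves.ModularForms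
  Summit.BirchSwinnertonDyer.BirchSwinnertonDyer.Theorems.ThetaLayerLambdaCongruenceAtTwo
  Summit.BirchSwinnertonDyer.BirchSwinnertonDyer.Theorems.ManinLocalTwoThree

namespace Summit.BirchSwinnertonDyer.BirchSwinnertonDyer.Theorems.MazurTateCongruenceAtTwoR

/-! ## §1. `ℤ[1/ℓ]`-translation invariance ⟹ `ℓ^{2k}`-dilation invariance -/

section Dilation

variable {K : Type*} [AddCommGroup K] {N : ℕ} (Φ : ℚ → K)

/-- The translation `x ↦ x + y` as an element of `GL₂(ℚ)` acts by `↑x ↦ ↑(x + y)`, `∞ ↦ ∞`; hence a `y`-periodic `Φ` satisfies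
the cocycle law for it: `Φ̃(T_y x) = Φ̃(T_y ∞) + Φ̃(x)`. [folklore] -/
theorem elim_translation_smul (y : ℚ) (hy : ∀ x : ℚ, Φ (x + y) = Φ x) (x : OnePoint ℚ) :
    ((Matrix.GeneralLinearGroup.mkOfDetNeZero (!![(1 : ℚ), y; 0, 1])
        (by rw [Matrix.det_fin_two_of]; norm_num) : GL (Fin 2) ℚ) • x).elim 0 Φ =
      ((Matrix.GeneralLinearGroup.mkOfDetNeZero (!![(1 : ℚ), y; 0, 1])
        (by rw [Matrix.det_fin_two_of]; norm_num) : GL (Fin 2) ℚ) • (OnePoint.infty : OnePoint ℚ)).elim 0 Φ +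
        x.elim 0 Φ := by
  set T : GL (Fin 2) ℚ := Matrix.GeneralLinearGroup.mkOfDetNeZero (!![(1 : ℚ), y; 0, 1])
    (by rw [Matrix.det_fin_two_of]; norm_num) with hT
  have h00 : T 0 0 = 1 := by simp [hT, Matrix.GeneralLinearGroup.mkOfDetNeZero]
  have h01 : T 0 1 = y := by simp [hT, Matrix.GeneralLinearGroup.mkOfDetNeZero]
  have h10 : T 1 0 = 0 := by simp [hT, Matrix.GeneralLinearGroup.mkOfDetNeZero]
  have h11 : T 1 1 = 1 := by simp [hT, Matrix.GeneralLinearGroup.mkOfDetNeZero]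
  have hinf : T • (OnePoint.infty : OnePoint ℚ) = OnePoint.infty := by
    rw [OnePoint.smul_infty_eq_self_iff]; exact h10
  rw [hinf, OnePoint.elim_infty, zero_add]
  induction x using OnePoint.rec with
  | infty => rw [hinf]
  | coe r =>
    rw [OnePoint.smul_some_eq_ite, h00, h01, h10, h11, zero_mul, zero_add, if_neg one_ne_zero, one_mul, div_one,
      OnePoint.elim_some, OnePoint.elim_some, hy]

/-- **`ℤ[1/ℓ]`-translation invariance ⟹ dilation invariance.** Let `Φ : ℚ → K` satisfy Manin's relation for `Γ₀(N)`,
`N = ℓ^e M` (`ℓ ≥ 1`), and let `k` with `M ∣ ℓ^k − 1`. If `Φ(x + j/ℓⁿ) = Φ(x)` for all `x`, `j ∈ ℤ`, `n`, then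
`Φ(ℓ^{2k} x) = Φ(x)` for all `x`: the diagonal `diag(ℓ^{-k}, ℓ^k) = (1 a;0 1)(1 0;c 1)(1 b;0 1)(1 0;d 1)` with
`a = ℓ^{-(2k+e)}`, `c = −ℓ^{k+e}(ℓ^k−1)`, `b = −ℓ^{-(k+e)}`, `d = ℓ^e(ℓ^k−1)` (lower unipotents in `Γ₀(N)`), and the cocycle law
`Φ̃(g x) = Φ̃(g∞) + Φ̃(x)` holds for each factor (`elim_mapGL_smul`, `elim_translation_smul`), hence for the product, which fixes
`∞` and acts by `x ↦ ℓ^{-2k} x`. [folklore] -/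
theorem dilationInvariant_of_translationInvariant
    (hΦ : ∀ (γ : CongruenceSubgroup.Gamma0 (N)) (r : ℚ), ((γ : SL(2, ℤ)) 1 0 : ℚ) * r + ((γ : SL(2, ℤ)) 1 1 : ℚ) ≠ 0 → Φ ((((γ : SL(2, ℤ)) 0 0 : ℚ) * r + ((γ : SL(2, ℤ)) 0 1 : ℚ)) / (((γ : SL(2, ℤ)) 1 0 : ℚ) * r + ((γ : SL(2, ℤ)) 1 1 : ℚ))) = (if ((γ : SL(2, ℤ)) 1 0) = 0 then 0 else Φ ((((γ : SL(2, ℤ)) 0 0 : ℚ)) / (((γ : SL(2, ℤ)) 1 0 : ℚ)))) + Φ r)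
    {ℓ e M k : ℕ} (hℓ : 0 < ℓ) (hN : N = ℓ ^ e * M) (hM : (M : ℤ) ∣ (ℓ : ℤ) ^ k - 1)
    (htr : ∀ (x : ℚ) (j : ℤ) (n : ℕ), Φ (x + j / (ℓ : ℚ) ^ n) = Φ x) :
    ∀ x : ℚ, Φ (((ℓ ^ (2 * k) : ℕ) : ℚ) * x) = Φ x := by
  obtain ⟨m₀, hm₀⟩ := hM
  have hℓ0 : (ℓ : ℚ) ≠ 0 := by exact_mod_cast hℓ.ne'
  -- the four factors
  set a : ℚ := ((ℓ : ℚ) ^ (2 * k + e))⁻¹ with ha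
  set b : ℚ := -((ℓ : ℚ) ^ (k + e))⁻¹ with hb
  set c : ℤ := -((ℓ : ℤ) ^ (k + e) * ((ℓ : ℤ) ^ k - 1)) with hc
  set d : ℤ := (ℓ : ℤ) ^ e * ((ℓ : ℤ) ^ k - 1) with hd
  have hcN : ((N : ℤ) : ZMod N) = 0 := by simp
  have hc_dvd : (N : ℤ) ∣ c := ⟨-((ℓ : ℤ) ^ k * m₀), by rw [hc, hN, hm₀]; push_cast; ring⟩
  have hd_dvd : (N : ℤ) ∣ d := ⟨m₀, by rw [hd, hN, hm₀]; push_cast; ring⟩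
  let Lc : SL(2, ℤ) := ⟨!![1, 0; c, 1], by rw [Matrix.det_fin_two_of]; ring⟩
  let Ld : SL(2, ℤ) := ⟨!![1, 0; d, 1], by rw [Matrix.det_fin_two_of]; ring⟩
  have hLc : Lc ∈ Gamma0 N := by
    rw [Gamma0_mem]; show ((c : ℤ) : ZMod N) = 0
    exact (ZMod.intCast_zmod_eq_zero_iff_dvd c N).mpr hc_dvd
  have hLd : Ld ∈ Gamma0 N := by
    rw [Gamma0_mem]; show ((d : ℤ) : ZMod N) = 0
    exact (ZMod.intCast_zmod_eq_zero_iff_dvd d N).mpr hd_dvd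
  set Ta : GL (Fin 2) ℚ := Matrix.GeneralLinearGroup.mkOfDetNeZero (!![(1 : ℚ), a; 0, 1])
    (by rw [Matrix.det_fin_two_of]; norm_num) with hTa
  set Tb : GL (Fin 2) ℚ := Matrix.GeneralLinearGroup.mkOfDetNeZero (!![(1 : ℚ), b; 0, 1])
    (by rw [Matrix.det_fin_two_of]; norm_num) with hTb
  -- translation invariance by `a` and `b` (both in `ℤ[1/ℓ]`)
  have htra : ∀ x : ℚ, Φ (x + a) = Φ x := fun x ↦ by
    have := htr x 1 (2 * k + e); rw [Int.cast_one, one_div] at this; rw [ha]; exact this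
  have htrb : ∀ x : ℚ, Φ (x + b) = Φ x := fun x ↦ by
    have := htr x (-1) (k + e); rw [Int.cast_neg, Int.cast_one, neg_div, one_div] at this; rw [hb]; exact this
  -- the product is the diagonal `diag(ℓ^{-k}, ℓ^k)`
  have hdetD : (!![((ℓ : ℚ) ^ k)⁻¹, 0; 0, (ℓ : ℚ) ^ k] : Matrix (Fin 2) (Fin 2) ℚ).det ≠ 0 := by
    rw [Matrix.det_fin_two_of]; simp [hℓ0]
  set D : GL (Fin 2) ℚ := Matrix.GeneralLinearGroup.mkOfDetNeZero _ hdetD with hD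
  have hprod : Ta * (mapGL ℚ Lc : GL (Fin 2) ℚ) * Tb * (mapGL ℚ Ld : GL (Fin 2) ℚ) = D := by
    apply Units.ext
    simp only [Units.val_mul, hTa, hTb, hD, Matrix.GeneralLinearGroup.mkOfDetNeZero]
    rw [show ((mapGL ℚ Lc : GL (Fin 2) ℚ) : Matrix (Fin 2) (Fin 2) ℚ) = !![(1 : ℚ), 0; (c : ℚ), 1] from by
        ext i j; fin_cases i <;> fin_cases j <;> simp [mapGL_rat_apply, Lc],
      show ((mapGL ℚ Ld : GL (Fin 2) ℚ) : Matrix (Fin 2) (Fin 2) ℚ) = !![(1 : ℚ), 0; (d : ℚ), 1] from by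
        ext i j; fin_cases i <;> fin_cases j <;> simp [mapGL_rat_apply, Ld]]
    have hℓk : (ℓ : ℚ) ^ k ≠ 0 := pow_ne_zero _ hℓ0
    have hℓke : (ℓ : ℚ) ^ (k + e) ≠ 0 := pow_ne_zero _ hℓ0
    have hℓ2ke : (ℓ : ℚ) ^ (2 * k + e) ≠ 0 := pow_ne_zero _ hℓ0
    rw [ha, hb, hc, hd]
    push_cast
    ext i j
    fin_cases i <;> fin_cases j <;>
      simp [Matrix.mul_apply, Fin.sum_univ_two, Matrix.cons_val', Matrix.cons_val_zero, Matrix.cons_val_one] <;>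
      field_simp <;> ring
  -- the cocycle law for the product
  have hP : ∀ x : OnePoint ℚ, ((Ta * (mapGL ℚ Lc : GL (Fin 2) ℚ) * Tb * (mapGL ℚ Ld : GL (Fin 2) ℚ)) • x).elim 0 Φ =
      (((mapGL ℚ Lc : GL (Fin 2) ℚ) • (OnePoint.infty : OnePoint ℚ)).elim 0 Φ +
        ((mapGL ℚ Ld : GL (Fin 2) ℚ) • (OnePoint.infty : OnePoint ℚ)).elim 0 Φ) + x.elim 0 Φ := by
    intro x
    rw [mul_smul, mul_smul, mul_smul, elim_translation_smul Φ a htra,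
      elim_mapGL_smul Φ hΦ ⟨Lc, hLc⟩ (Tb • (mapGL ℚ Ld : GL (Fin 2) ℚ) • x), elim_translation_smul Φ b htrb,
      elim_mapGL_smul Φ hΦ ⟨Ld, hLd⟩ x]
    have e1 : (Ta • (OnePoint.infty : OnePoint ℚ)) = OnePoint.infty := by
      rw [OnePoint.smul_infty_eq_self_iff]; simp [hTa, Matrix.GeneralLinearGroup.mkOfDetNeZero]
    have e2 : (Tb • (OnePoint.infty : OnePoint ℚ)) = OnePoint.infty := by
      rw [OnePoint.smul_infty_eq_self_iff]; simp [hTb, Matrix.GeneralLinearGroup.mkOfDetNeZero]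
    rw [e1, e2, OnePoint.elim_infty, zero_add, zero_add]
    abel
  -- at `x = ∞` the product fixes `∞`, so the sum of cocycle terms vanishes
  have hDinf : D • (OnePoint.infty : OnePoint ℚ) = OnePoint.infty := by
    rw [OnePoint.smul_infty_eq_self_iff]; simp [hD, Matrix.GeneralLinearGroup.mkOfDetNeZero]
  have h0 := hP OnePoint.infty
  rw [hprod, hDinf, OnePoint.elim_infty, add_zero] at h0
  intro x
  have hx := hP ((((ℓ ^ (2 * k) : ℕ) : ℚ) * x : ℚ) : OnePoint ℚ)
  rw [hprod, ← h0, zero_add, OnePoint.elim_some] at hx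
  rw [← hx]
  have h00 : D 0 0 = ((ℓ : ℚ) ^ k)⁻¹ := by simp [hD, Matrix.GeneralLinearGroup.mkOfDetNeZero]
  have h01 : D 0 1 = 0 := by simp [hD, Matrix.GeneralLinearGroup.mkOfDetNeZero]
  have h10 : D 1 0 = 0 := by simp [hD, Matrix.GeneralLinearGroup.mkOfDetNeZero]
  have h11 : D 1 1 = (ℓ : ℚ) ^ k := by simp [hD, Matrix.GeneralLinearGroup.mkOfDetNeZero]
  rw [OnePoint.smul_some_eq_ite, h00, h01, h10, h11, zero_mul, zero_add, if_neg (pow_ne_zero _ hℓ0), add_zero,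
    OnePoint.elim_some]
  congr 1
  push_cast
  field_simp
  ring

end Dilation

/-! ## §2. (IH₂-core): reduction modulo the maximal ideal of `𝒪_{ℚ̄₂}` and Ihara for symbol functions -/

section Main

/-- **(IH₂-core), abstract system of eigenvalues.** Let `a : ℕ → ℤ` be a system of integers which is NOT a weight-`2` Eisenstein
system in characteristic `2` (over every field of characteristic `2`). Let `N ≥ 1`, `ℓ` a prime (`ℓ ∣ N` allowed), and let
`Φ : ℚ → ℚ̄₂` be a `Γ₀(N)`-symbol function (Manin's relation), integral (`‖Φ‖ ≤ 1`), Hecke-congruent to `a` off the primes of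
`2 N ℓ` (`‖∑_{j<q} Φ((r+j)/q) + Φ(qr) − a_q Φ(r)‖ < 1`) and `ℤ[1/ℓ]`-periodic modulo `𝔪` (`‖Φ(r + j/ℓⁿ) − Φ(r)‖ < 1`). Then
`‖Φ(r)‖ < 1` for every `r`: the reduction `Ψ = Φ mod 𝔪 : ℚ → 𝓀` is a `Γ₀(N)`-symbol function, exactly Hecke-eigen, and (§1)
invariant under dilation by `ℓ^{2φ(M)}` (`N = ℓ^e M`, `ℓ ∤ M`), hence `Ψ = 0` by `eq_zero_of_dilationInvariant`.
[cite: GreenbergVatsal2000, §3 (un-depletion via Ihara; p odd there)] [cite: Ribet1984ICM, Thm. 4.1 (shape)] -/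
theorem norm_lt_one_of_translationInvariant {N : ℕ} (hN : 0 < N) {ℓ : ℕ} (hℓ : ℓ.Prime) (a : ℕ → ℤ)
    (hne : ∀ (F : Type) [Field F] [CharP F 2], ¬ IsEisensteinEigensystem 2 (fun q : ℕ ↦ ((a q : ℤ) : F)))
    (Φ : ℚ → PadicAlgCl 2)
    (hΦ : ∀ (γ : CongruenceSubgroup.Gamma0 (N)) (r : ℚ), ((γ : SL(2, ℤ)) 1 0 : ℚ) * r + ((γ : SL(2, ℤ)) 1 1 : ℚ) ≠ 0 → Φ ((((γ : SL(2, ℤ)) 0 0 : ℚ) * r + ((γ : SL(2, ℤ)) 0 1 : ℚ)) / (((γ : SL(2, ℤ)) 1 0 : ℚ) * r + ((γ : SL(2, ℤ)) 1 1 : ℚ))) = (if ((γ : SL(2, ℤ)) 1 0) = 0 then 0 else Φ ((((γ : SL(2, ℤ)) 0 0 : ℚ)) / (((γ : SL(2, ℤ)) 1 0 : ℚ)))) + Φ r)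
    (hle : ∀ r : ℚ, ‖Φ r‖ ≤ 1)
    (hT : ∀ q : ℕ, q.Prime → ¬ q ∣ 2 * N * ℓ → ∀ r : ℚ,
      ‖(∑ j : Fin q, Φ ((r + j) / q)) + Φ (q * r) - (a q : PadicAlgCl 2) * Φ r‖ < 1)
    (htr : ∀ (r : ℚ) (j : ℤ) (n : ℕ), ‖Φ (r + j / (ℓ : ℚ) ^ n) - Φ r‖ < 1) :
    ∀ r : ℚ, ‖Φ r‖ < 1 := by
  classical
  haveI := charP_residueField_two
  haveI : NeZero N := ⟨hN.ne'⟩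
  set res := IsLocalRing.residue (Valued.integer (PadicAlgCl 2)) with hres
  have m : ∀ r : ℚ, Φ r ∈ Valued.integer (PadicAlgCl 2) := fun r ↦ mem_integer_two_iff_norm_le_one.mpr (hle r)
  set Ψ : ℚ → IsLocalRing.ResidueField (Valued.integer (PadicAlgCl 2)) := fun r ↦ res ⟨Φ r, m r⟩ with hΨ
  -- transfer of Manin's relation (a ring map; adapted from `…ResidualReduction.plusLineAtTwo_of_charTwo`)
  have hΨM : ∀ (γ : CongruenceSubgroup.Gamma0 (N)) (r : ℚ), ((γ : SL(2, ℤ)) 1 0 : ℚ) * r + ((γ : SL(2, ℤ)) 1 1 : ℚ) ≠ 0 → Ψ ((((γ : SL(2, ℤ)) 0 0 : ℚ) * r + ((γ : SL(2, ℤ)) 0 1 : ℚ)) / (((γ : SL(2, ℤ)) 1 0 : ℚ) * r + ((γ : SL(2, ℤ)) 1 1 : ℚ))) = (if ((γ : SL(2, ℤ)) 1 0) = 0 then 0 else Ψ ((((γ : SL(2, ℤ)) 0 0 : ℚ)) / (((γ : SL(2, ℤ)) 1 0 : ℚ)))) + Ψ r := by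
    intro γ r hr
    have h := hΦ γ r hr
    simp only [hΨ]
    by_cases hc : (γ : SL(2, ℤ)) 1 0 = 0
    · rw [if_pos hc, zero_add] at h
      rw [if_pos hc, zero_add]
      congr 1
      exact Subtype.ext h
    · rw [if_neg hc] at h
      rw [if_neg hc, ← map_add]
      congr 1
      exact Subtype.ext h
  -- transfer of the Hecke congruences (exact in `𝓀`)
  have hΨT : ∀ q : ℕ, q.Prime → ¬ q ∣ 2 * N * ℓ → ∀ r : ℚ,
      (∑ j : Fin q, Ψ ((r + j) / q)) + Ψ (q * r) =
        ((a q : ℤ) : IsLocalRing.ResidueField (Valued.integer (PadicAlgCl 2))) * Ψ r := by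
    intro q hq hqN r
    have ma : ((a q : ℤ) : PadicAlgCl 2) ∈ Valued.integer (PadicAlgCl 2) :=
      mem_integer_two_iff_norm_le_one.mpr (norm_intCast_padicAlgCl_two_le_one _)
    set E : Valued.integer (PadicAlgCl 2) :=
      (∑ j : Fin q, (⟨Φ ((r + j) / q), m _⟩ : Valued.integer (PadicAlgCl 2))) + ⟨Φ (q * r), m _⟩ -
        ⟨((a q : ℤ) : PadicAlgCl 2), ma⟩ * ⟨Φ r, m r⟩ with hE
    have hEval : (E : PadicAlgCl 2) =
        (∑ j : Fin q, Φ ((r + j) / q)) + Φ (q * r) - (a q : PadicAlgCl 2) * Φ r := by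
      rw [hE]; push_cast; rfl
    have hE0 : res E = 0 := by
      rw [hres, residue_two_eq_zero_iff, hEval]; exact hT q hq hqN r
    rw [hE, map_sub, map_add, map_sum, map_mul, sub_eq_zero] at hE0
    simp only [hΨ]
    rw [hE0, residue_two_mk_intCast _ ma]
  -- transfer of the translation congruences
  have hΨtr : ∀ (x : ℚ) (j : ℤ) (n : ℕ), Ψ (x + j / (ℓ : ℚ) ^ n) = Ψ x := by
    intro x j n
    have hmem : Φ (x + j / (ℓ : ℚ) ^ n) - Φ x ∈ Valued.integer (PadicAlgCl 2) := sub_mem (m _) (m _)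
    have h0 : res ⟨_, hmem⟩ = 0 := (residue_two_mk_eq_zero_iff hmem).mpr (htr x j n)
    have e : (⟨Φ (x + j / (ℓ : ℚ) ^ n) - Φ x, hmem⟩ : Valued.integer (PadicAlgCl 2)) =
        ⟨Φ (x + j / (ℓ : ℚ) ^ n), m _⟩ - ⟨Φ x, m x⟩ := Subtype.ext rfl
    rw [e, map_sub, sub_eq_zero] at h0
    exact h0
  -- dilation invariance by `ℓ^{2k}`, `k = φ(M)`, `N = ℓ^e M`
  have hNfac : N = ℓ ^ (N.factorization ℓ) * (N / ℓ ^ (N.factorization ℓ)) := (Nat.ordProj_mul_ordCompl_eq_self N ℓ).symm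
  have hMpos : 0 < N / ℓ ^ (N.factorization ℓ) := Nat.ordCompl_pos ℓ hN.ne'
  have hk : 1 ≤ Nat.totient (N / ℓ ^ (N.factorization ℓ)) := Nat.totient_pos.mpr hMpos
  have hMdvd : ((N / ℓ ^ (N.factorization ℓ) : ℕ) : ℤ) ∣ (ℓ : ℤ) ^ (Nat.totient (N / ℓ ^ (N.factorization ℓ))) - 1 := by
    have h := (Nat.ModEq.pow_totient (Nat.coprime_ordCompl hℓ hN.ne')).symm
    rw [Nat.modEq_iff_dvd] at h
    push_cast at h
    exact h
  have hdil := dilationInvariant_of_translationInvariant Ψ hΨM hℓ.pos hNfac hMdvd hΨtr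
  -- Ihara for symbol functions in the residue field
  set S : Finset ℕ := (2 * ℓ * N).primeFactors with hSdef
  have hS : ∀ q : ℕ, q.Prime → q ∣ 2 * ℓ * N → q ∈ S :=
    fun q hq hd ↦ Nat.mem_primeFactors.mpr ⟨hq, hd, mul_ne_zero (mul_ne_zero two_ne_zero hℓ.ne_zero) hN.ne'⟩
  have hT' : ∀ q : ℕ, q.Prime → q ∉ S → ∀ r : ℚ, (∑ j : Fin q, Ψ ((r + j) / q)) + Ψ (q * r) =
      (fun q : ℕ ↦ ((a q : ℤ) : IsLocalRing.ResidueField (Valued.integer (PadicAlgCl 2)))) q * Ψ r := by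
    intro q hq hqS r
    refine hΨT q hq (fun hd ↦ hqS (hS q hq ?_)) r
    rw [mul_right_comm]; exact hd
  have hne' : ¬ IsEisensteinEigensystem 2 (fun q : ℕ ↦
      algebraMap (IsLocalRing.ResidueField (Valued.integer (PadicAlgCl 2)))
        (AlgebraicClosure (IsLocalRing.ResidueField (Valued.integer (PadicAlgCl 2))))
        ((fun q : ℕ ↦ ((a q : ℤ) : IsLocalRing.ResidueField (Valued.integer (PadicAlgCl 2)))) q)) := by
    have h := hne (AlgebraicClosure (IsLocalRing.ResidueField (Valued.integer (PadicAlgCl 2))))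
    simpa only [map_intCast] using h
  have hzero := eq_zero_of_dilationInvariant Nat.prime_two hℓ (by omega : 1 ≤ 2 * Nat.totient (N / ℓ ^ (N.factorization ℓ)))
    (IsLocalRing.ResidueField (Valued.integer (PadicAlgCl 2))) S hS _ hne' Ψ hΨM hT' hdil
  intro r
  exact (residue_two_mk_eq_zero_iff (m r)).mp (hzero r)

/-- **(IH₂-core) for the Hecke system of an elliptic curve** — the registered shape of `stub_iharaSymbolModTwo` (skeleton `symbol`
v4) with the NON-EISENSTEIN input made an explicit binder after `GoodSS W 2` (the `1`-periodicity, evenness and good-reduction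
binders of the stub are not used): for every `W/ℚ`, every odd `N'`, every odd prime `ℓ`, every integral `Γ₀(N')`-symbol function
`Φ : ℚ → ℚ̄₂` Hecke-congruent to `a_q(W)` off `2N'ℓ` and `ℤ[1/ℓ]`-periodic modulo `𝔪`: `‖Φ(r)‖ < 1` for all `r`. The non-Eisenstein
input «`ℓ ↦ a_ℓ(W) mod 2` is not a weight-`2` Eisenstein system over any field of characteristic `2`» holds when `W[2]` is
irreducible with `Δ_W < 0` (image `S₃`; Chebotarev) and FAILS for `C₃`-image, where (IH₂-core) itself fails (Eisenstein boundary
symbols). [cite: GreenbergVatsal2000, §3 (un-depletion via Ihara; p odd there)] -/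
theorem iharaSymbolModTwo_of_notEisenstein (W : WeierstrassCurve ℚ) [W.IsElliptic] [W.IsGloballyMinimal]
    (_hss : Literature.NumberTheory.EllipticCurves.Rank1Residual.GoodSS W 2)
    (hne : ∀ (F : Type) [Field F] [CharP F 2], ¬ IsEisensteinEigensystem 2 (fun q : ℕ ↦ ((W.LFunction q : ℤ) : F)))
    (N' : ℕ) (hN' : Odd N')
    (_hgood : ∀ v : IsDedekindDomain.HeightOneSpectrum (NumberField.RingOfIntegers ℚ),
      ¬ ((Rat.HeightOneSpectrum.primesEquiv v : ℕ) ∣ 2 * N') → W.HasGoodReductionAt v)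
    (ℓ : ℕ) (hℓ : ℓ.Prime) (_hℓ2 : ℓ ≠ 2) (Φ : ℚ → PadicAlgCl 2)
    (_hper : ∀ (r : ℚ) (z : ℤ), Φ (r + z) = Φ r) (_hev : ∀ r : ℚ, Φ (-r) = Φ r)
    (hΦ : ∀ (γ : CongruenceSubgroup.Gamma0 (N')) (r : ℚ), ((γ : SL(2, ℤ)) 1 0 : ℚ) * r + ((γ : SL(2, ℤ)) 1 1 : ℚ) ≠ 0 → Φ ((((γ : SL(2, ℤ)) 0 0 : ℚ) * r + ((γ : SL(2, ℤ)) 0 1 : ℚ)) / (((γ : SL(2, ℤ)) 1 0 : ℚ) * r + ((γ : SL(2, ℤ)) 1 1 : ℚ))) = (if ((γ : SL(2, ℤ)) 1 0) = 0 then 0 else Φ ((((γ : SL(2, ℤ)) 0 0 : ℚ)) / (((γ : SL(2, ℤ)) 1 0 : ℚ)))) + Φ r)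
    (hle : ∀ r : ℚ, ‖Φ r‖ ≤ 1)
    (hT : ∀ q : ℕ, q.Prime → ¬ q ∣ 2 * N' * ℓ → ∀ r : ℚ,
      ‖(∑ j : Fin q, Φ ((r + j) / q)) + Φ (q * r) - (W.LFunction q : PadicAlgCl 2) * Φ r‖ < 1)
    (htr : ∀ (r : ℚ) (j : ℤ) (n : ℕ), ‖Φ (r + j / (ℓ : ℚ) ^ n) - Φ r‖ < 1) :
    ∀ r : ℚ, ‖Φ r‖ < 1 :=
  norm_lt_one_of_translationInvariant hN'.pos hℓ (fun q ↦ W.LFunction q) hne Φ hΦ hle hT htr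

end Main

end Summit.BirchSwinnertonDyer.BirchSwinnertonDyer.Theorems.MazurTateCongruenceAtTwoR

end
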